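import Summits.AtomisticToContinuum.FouriersLaw.Theorems.IncoherentChannel.Negative.HarmonicFlow

/-!
# `IncoherentChannel`, line `two-horizons-forecast-loss` — the free harmonic flow commutes with its drift

Helper file for the lead's harmonic calibration of the one-time engine of crux
`PhononMeanFreePath.IncoherentChannel` (item stmt-AtomisticToContinuum-11811, route `PhononMeanFreePath`,
sub-problem `FouriersLaw`). For the pinned HARMONIC chain `P = pinnedChain ω₂ 0 0 γ` (`ω₂ > 0`, `γ ≥ 0`) the
Langevin drift `Y = P.drift n` is a (continuous) LINEAR vector field (`harmonic_drift_add/_smul` of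
`Negative.HarmonicFlow`), and the deterministic (zero-noise) constructed flow `Φ_t x = P.chainFlow n x 0 t`
solves `Φ_t x = x + ∫₀ᵗ Y (Φ_s x) ds` (`t ≥ 0`) and is clamped at `x` for `t ≤ 0`.

* `harmonic_drift_exists_clm` — `Y` is (the coercion of) a continuous linear map `PhaseSpace n →L[ℝ] PhaseSpace n`;
* `harmonic_freeFlow_drift_comm` (registered, W-B) — **`Φ_t (Y x) = Y (Φ_t x)` for every real `t`**
  ("`W(t) A = A W(t)`" without any matrix exponential): applying the continuous linear map `Y` to the
  integral equation and pushing it through the interval integral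
  (`ContinuousLinearMap.intervalIntegral_comp_comm`) shows that `s ↦ Y (Φ_s x)` is a continuous solution of
  the same integral equation started at `Y x`, hence equals `s ↦ Φ_s (Y x)` by uniqueness
  (`pinnedChain_eqOn_chainFlow`); for `t ≤ 0` both sides are `Y x`.

No definitions; nothing here closes an item.
-/

noncomputable section

namespace Summit.AtomisticToContinuum.FouriersLaw.Theorems.PhononMeanFreePath

open MeasureTheory Set Filter Topology
open scoped NNReal
open Literature.MathematicalPhysics.KineticTheory.HeatConduction
open Summit.AtomisticToContinuum.FouriersLaw.Theorems.IncoherentChannel.Negative.HarmonicFlow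

section HarmonicDriftComm

variable {ω₂ γ : ℝ} (n : ℕ)

/-- The harmonic Langevin drift `Y = (pinnedChain ω₂ 0 0 γ).drift n` is a continuous linear map of the
phase space (linear force, linear friction; continuity from smoothness of the drift). [folklore] -/
theorem harmonic_drift_exists_clm :
    ∃ L : PhaseSpace n →L[ℝ] PhaseSpace n, ∀ x, L x = (pinnedChain ω₂ 0 0 γ).drift n x := by
  have hDc : Continuous ((pinnedChain ω₂ 0 0 γ).drift n) :=
    (pinnedChain_contDiff_drift ω₂ 0 0 γ n (n := 0)).continuous
  refine ⟨⟨{ toFun := (pinnedChain ω₂ 0 0 γ).drift n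
             map_add' := fun a b => harmonic_drift_add n a b
             map_smul' := fun s a => ?_ }, hDc⟩, fun x => rfl⟩
  simpa using harmonic_drift_smul n s a

end HarmonicDriftComm

/-- **The free harmonic flow commutes with its drift** (W-B): for the pinned harmonic chain
`P = pinnedChain ω₂ 0 0 γ` (`ω₂ > 0`, `γ ≥ 0`), the deterministic flow `Φ_t x = P.chainFlow n x 0 t` and the
linear drift `Y = P.drift n` satisfy `Φ_t (Y x) = Y (Φ_t x)` for every `x` and every real `t` (uniqueness of
continuous solutions of the linear integral equation `z(t) = Y x + ∫₀ᵗ Y (z s) ds`, which both sides solve;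
trivial for `t ≤ 0` where the flow is clamped). [folklore] -/
theorem harmonic_freeFlow_drift_comm : ∀ ω₂ γ : ℝ, 0 < ω₂ → 0 ≤ γ → ∀ (n : ℕ) (x : PhaseSpace n) (t : ℝ), (pinnedChain ω₂ 0 0 γ).chainFlow n ((pinnedChain ω₂ 0 0 γ).drift n x) 0 t = (pinnedChain ω₂ 0 0 γ).drift n ((pinnedChain ω₂ 0 0 γ).chainFlow n x 0 t) := by
  intro ω₂ γ hω hγ n x t
  rcases le_or_gt t 0 with ht | ht
  · rw [pinnedChain_freeFlow_of_nonpos n _ ht, pinnedChain_freeFlow_of_nonpos n _ ht]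
  · obtain ⟨L, hL⟩ := harmonic_drift_exists_clm (ω₂ := ω₂) (γ := γ) n
    have hc : Continuous ((pinnedChain ω₂ 0 0 γ).chainFlow n x 0) :=
      pinnedChain_continuous_chainFlow hω le_rfl le_rfl hγ n x (η := 0) continuous_zero
    set z : ℝ → PhaseSpace n := fun r =>
      (pinnedChain ω₂ 0 0 γ).drift n ((pinnedChain ω₂ 0 0 γ).chainFlow n x 0 r) with hz
    have hzc : Continuous z := L.continuous.comp hc |>.congr fun r => hL _
    have hsol : Literature.Analysis.ODE.IsIntegralSolutionOn ((pinnedChain ω₂ 0 0 γ).drift n)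
        (OscillatorChain.forcing ((pinnedChain ω₂ 0 0 γ).drift n x) 0) z t := by
      intro r hr
      have e := pinnedChain_freeFlow_eq_integral hω le_rfl le_rfl hγ n x hr.1
      have hI : IntervalIntegrable (fun τ => L ((pinnedChain ω₂ 0 0 γ).chainFlow n x 0 τ)) volume 0 r :=
        (L.continuous.comp hc).intervalIntegrable _ _
      simp only [hz]
      rw [e]
      simp only [← hL, map_add, OscillatorChain.forcing]
      rw [← L.intervalIntegral_comp_comm hI]
      simp
    exact (pinnedChain_eqOn_chainFlow hω le_rfl le_rfl hγ n ((pinnedChain ω₂ 0 0 γ).drift n x) (η := 0)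
      continuous_zero hsol hzc ⟨ht.le, le_rfl⟩).symm

end Summit.AtomisticToContinuum.FouriersLaw.Theorems.PhononMeanFreePath

end
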